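import Summits.BirchSwinnertonDyer.Rank1Residual.ManinAdditive.NeronOmegaThreeFrickeTrace
import Summits.BirchSwinnertonDyer.Rank1Residual.ManinAdditive.NeronOmegaTwo
import HarnessLib
import HarnessLib.Audit.Tags

/-!
# «DEFECT = GENUS»: the index of the E-blind dualising-sheaf lattice `Ω_p(N)` in the reduced-cusp lattice `L_red(N)`
# is `p^{g(X₀(N/9))}` at `p = 3` (`9 ∣ N`, `81 ∤ N`) and `2^{g(X₀(N/16))}` at `p = 2` (`16 ∣ N`, `64 ∤ N`) — E-imc-165 / 166 / 168 typed
# (cell `bsd-f2-manin`, imc g22 planner-of-record, MEMO-imc §28; typing asks T-imc-32 / 32c / 32d; typer g17)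

TYPER NOTE.  SOURCE = HOME/imc/kit-g22/Sketch-imc-g22c.lean sha16 8e333f291e6b0de1 (150 l.; = Sketch-imc-g22.lean e97efd5b34f181a3
+ the two E-imc-168 «Deep» rows; farm rc 0 · 0 sorries per imc; BC7 6/6 + 2/2 CLEAN, g22-bc7.raw.txt) and, as §5, the five PROVED
support lemmas of Sketch-imc-g22b.lean 57b40461bb0e7a35 (69 l., farm rc 0 · 0 warnings per imc; T-imc-32c), landed VERBATIM except:
(i) this note; (ii) namespace `…NeronOmegaGenusG22` folded to `…ManinAdditive.NeronOmegaGenus`; (iii) the `#h21_crux_probe` commands and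
the `HarnessLib.Audit.CruxProbe` import dropped (imc's request); (iv) four bookkeeping theorems received one-line docstrings; (v) the
second `§3` heading renumbered `§4`.  Six `@[conjecture]` obligation nodes (nothing asserted) + definitions + PROVED bookkeeping.
REFUTER VERDICTS: R-imc-65 (ref1: MEMO §28.3 mechanism audit + second genus engine) PENDING at filing; repairs land under NEW names.
[cite: Edixhoven1991, §1 (shape only: the regular model of `X₀(N)` at `p² ∣ N` and its non-reduced components; the «defect = genus» law is the cell's E-imc-165/166/168 — MEMO-imc §28, NOT in print)]

LENS = Iwasawa-main-conjecture / integrality of families (cell `bsd-f2-manin`, seat `-imc` g22, planner-of-record; MEMO-imc §28).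

THE LAW (E-blind, level-wise, found 2026-08-29 in the cell's own ENGINE 7e/8b tables, 0 exceptions on its natural domain):
  `[L_red(N) : Ω₃(N)] = 3^{g(X₀(N/9))}`   for `9 ∣ N`, `81 ∤ N`    — 109/109 levels (`9 ∣ N ≤ 960` all 90 + OOS `963…1107` 19; ENGINE 8b
      column `o[Lred:LOM]`, kit j320278 / j320279, table g22/defect-genus-p3.txt 43a633198caa70c4), INCLUDING `27 ∥ N` where `g(X₀(3K)) = 2g(X₀(K)) + #ss − 1`;
  `[L_red^gen(N) : Ω₂(N)] = 2^{g(X₀(N/16))}`  for `16 ∣ N`, `64 ∤ N` — 45/45 levels (`v₂ = 4`: 30/30, `v₂ = 5`: 15/15; ENGINE 7e column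
      `o[Lred:LOM]`, kit j321173 / j321324, table g22/defect-genus-p2.txt 5a6ff6fffe569eef); at `v₂ ≥ 6` (a multiplicity-4 component appears)
      the index EXCEEDS `2^g` by one factor 2 at 704, 896, 960 (7/10) — outside the law's domain, predicted sign of the excess.
DOMAIN = «every non-reduced Katz–Mazur component of `X₀(N)_{𝔽_p}` has multiplicity exactly 2» (`φ(3) = 2`: `v₃ ∈ {2,3}`; `φ(4) = 2`: `v₂ ∈ {4,5}`).
MECHANISM (paper, modulo the cell's audited dictionary (D1)–(D5), HOME/imc/PROOFS-g19.md §0): let `D ⊂ 𝒳 = X₀(N)_{ℤ_p}` (Edixhoven's regular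
model) be the REDUCED curve underlying the non-reduced components; stripping the common Igusa level `p^h` (`h₃ = 1`, `h₂ = 2`) from each
non-reduced component `(a,b) ↦ (a−h, b−h)` identifies `D ≅ X₀(N/p^{2h})_{𝔽_p}` as reduced curves (one `X₀(K)` at `v = 2h`; the two
Deligne–Rapoport components glued at the supersingular points at `v = 2h+1`), so `p_a(D) = g(X₀(N/p^{2h}))`.  Then
 (i)  LP law «PAIR» (E-imc-149, PROOFS-g21 Thm A/B; certified): `L_red = H⁰(𝒳, ω_𝒳(D))` — pole order ≤ 1 along each multiplicity-2 component;
 (ii) adjunction `ω_𝒳(D)|_D = ω_D` and `Ω_p(N) = H⁰(𝒳, ω_𝒳)` (definition of the E-blind lattice, dictionary (D1)–(D5));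
 (iii) `H¹(𝒳, ω_𝒳) ≅ ℤ_p` torsion-free (Grothendieck duality + cohomological flatness: the outer components are reduced, gcd of multiplicities 1),
      so `0 → H⁰(ω_𝒳) → H⁰(ω_𝒳(D)) → H⁰(D, ω_D) → 0` is exact;
hence `L_red/Ω_p ≅ H⁰(D, ω_D)`, an `𝔽_p`-vector space of dimension `p_a(D) = g(X₀(N/p^{2h}))`; in particular `p · L_red ⊆ Ω_p` (E-165♭/166♭),
which EXPLAINS the census invariant `σ^Ω ∈ {0,1}` (687/687 at `p = 3`, 334/334 at `p = 2`) and `Ω = L_red` exactly at the genus-0 levels.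
HECKE REFINEMENT (conjectural, NOT typed here; kit ENGINE 9 j322336 tests it): `L_red/Ω₃ ≅ S₂(Γ₀(N/9); 𝔽₃) ⊗ ω^{i₀}` as a module over the
prime-to-`3N` Hecke algebra, so `σ^Ω(f) = 1 ⟹ ρ̄_{f,3} ⊗ ω^{−i₀}` arises from `S₂(Γ₀(N/9); 𝔽̄₃)`; at `9 ∥ N` (tame: only `I₀*, Iₙ*, III, III*`
occur, `III ↔ III*` under `⊗χ₋₃`) this is the representation-theoretic content of law L3g «`σ^Ω = 1 ⟺ III*`».
NOT IN PRINT as a statement about `Ω` vs `L_red` (imc presearch, MEMO §28.6): the ingredients (Edixhoven 1990 regular model, Raynaud's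
`Lie(Pic⁰) = H¹(𝒪)` for cohomologically flat curves, Deligne–Rapoport) are print; the identification of the DEFECT with `g(X₀(N/9))` / `g(X₀(N/16))`
and its E-facing Hecke reading are the cell's.  Nothing below is asserted: four `@[conjecture] def`s + proved bookkeeping.
PARTITION (imc) ladder-adjacent · beyond-print theorem: no (paper theorem modulo the dictionary + PAIR) · `3 ∤ c_E` is NOT proved by this;
BSD is not proved by this; Manin's conjecture is not proved by this; C2/C3 stay OPEN.  bears_on: stmt-BirchSwinnertonDyer-22968 (C3), -22967 (C2).
-/

noncomputable section

open scoped MatrixGroups ModularForm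
open CongruenceSubgroup Literature.NumberTheory.EllipticCurves.ModularForms
  Summit.BirchSwinnertonDyer.Rank1Residual.ManinAdditive
  Summit.BirchSwinnertonDyer.Rank1Residual.ManinAdditive.NeronCuspThree
  Summit.BirchSwinnertonDyer.Rank1Residual.ManinAdditive.NeronOmegaThree
  Summit.BirchSwinnertonDyer.Rank1Residual.ManinAdditive.NeronOmegaTwo

namespace Summit.BirchSwinnertonDyer.Rank1Residual.ManinAdditive.NeronOmegaGenus

/-! ### §1. `p = 3` -/

/-- `L_red(N)` at `3`: the largest sub-`ℤ`-module of `S₂(Γ₀(N); ℤ)` whose elements have `3`-adically integral `w = w_{3^{v₃(N)}}`-transform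
(the `q`-expansion conditions at the cusps of the two REDUCED outer Katz–Mazur components `∞`, `0`; 3-adically `S ∩ wS`). -/
def reducedCuspLatticeAtThree (N : ℕ) [NeZero N] : Submodule ℤ (CuspForm (Gamma0 N) 2) :=
  sSup {L | L ≤ integralCuspForms0 N 2 ∧ ∀ x ∈ L, IsThreeIntegral N (atkinLehnerInvolutionAt N 2 3 x)}

/-- `L_red(N) ≤ S₂(Γ₀(N); ℤ)`. -/
theorem reducedCuspLatticeAtThree_le (N : ℕ) [NeZero N] : reducedCuspLatticeAtThree N ≤ integralCuspForms0 N 2 :=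
  sSup_le fun _ hL => hL.1

/-- `Ω₃(N) ≤ L_red(N)` (the `C_0`-row of `Ω₃` is the `L_red` condition). -/
theorem omegaLatticeAtThree_le_reduced (N : ℕ) [NeZero N] : omegaLatticeAtThree N ≤ reducedCuspLatticeAtThree N :=
  sSup_le fun _ hM => le_sSup ⟨hM.1, fun x hx => (hM.2 x hx).1⟩

/-- The **Ω-defect index** `[L_red(N) : Ω₃(N)]` (a power of 3: both lattices are cut out of `S₂(Γ₀(N); ℤ)` by 3-local conditions). -/
def omegaDefectIndexAtThree (N : ℕ) [NeZero N] : ℕ :=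
  (omegaLatticeAtThree N).toAddSubgroup.relIndex (reducedCuspLatticeAtThree N).toAddSubgroup

/-- **E-imc-165 `OmegaDefectEqGenusAtThree` («DEFECT = GENUS» at 3).**  For `N = 9M` with `9 ∤ M` (i.e. `9 ∣ N`, `81 ∤ N`):
`[L_red(N) : Ω₃(N)] = 3^{g(X₀(M))}`, `g(X₀(M)) = dim_ℂ S₂(Γ₀(M))`.  BC5: 109/109 levels (ENGINE 8b `o[Lred:LOM]` = `g(X₀(N/9))`,
kit j320278 all 90 levels `9 ∣ N ≤ 960`, `81 ∤ N`, + j320279 OOS 19 levels `963…1107`; 0 exceptions; pre-registered P-g22-1 for `1116…1296`).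
Why it might fail: only with the PAIR law (i) or the cohomological-flatness step (iii) of the mechanism; cheapest falsifier = one level with
`o[Lred:LOM] ≠ g(X₀(N/9))`. -/
@[conjecture] def OmegaDefectEqGenusAtThree : Prop :=
  ∀ (M : ℕ) [NeZero M], ¬ 9 ∣ M →
    omegaDefectIndexAtThree (9 * M) = 3 ^ Module.finrank ℂ (CuspForm (Gamma0 M) 2)

/-- **E-imc-165♭ `OmegaDefectKilledByThree`** (the exponent part; = the PAIR law E-imc-149 read on `L_red`): for `9 ∣ N`, `81 ∤ N`,
`3 · L_red(N) ⊆ Ω₃(N)`.  Consequence: every optimal `f` has `σ^Ω(f) ≤ 1` (ENGINE 7: 687/687). -/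
@[conjecture] def OmegaDefectKilledByThree : Prop :=
  ∀ (M : ℕ) [NeZero M], ¬ 9 ∣ M →
    ∀ x ∈ reducedCuspLatticeAtThree (9 * M), (3 : ℤ) • x ∈ omegaLatticeAtThree (9 * M)

/-! ### §2. `p = 2` -/

/-- The **Ω-defect index at 2** `[L_red^gen(N) : Ω₂(N)]` (tree lattices `NeronOmegaTwo.kmCuspLatticeGen`, `NeronOmegaTwo.omegaLatticeAtTwo`). -/
def omegaDefectIndexAtTwo (N : ℕ) [NeZero N] : ℕ :=
  (omegaLatticeAtTwo N).toAddSubgroup.relIndex (kmCuspLatticeGen N).toAddSubgroup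

/-- **E-imc-166 `OmegaDefectEqGenusAtTwo` («DEFECT = GENUS» at 2).**  For `N = 16K` with `4 ∤ K` (i.e. `16 ∣ N`, `64 ∤ N`):
`[L_red^gen(N) : Ω₂(N)] = 2^{g(X₀(K))}`.  BC5: 45/45 levels (ENGINE 7e `o[Lred:LOM]`, kit j321173 + j321324: `v₂ = 4` 30/30 `N ≤ 1008`,
`v₂ = 5` 15/15 `N ≤ 992`).  Deliberately NOT claimed at `64 ∣ N` (multiplicity-4 component; excess +1 observed at 704, 896, 960). -/
@[conjecture] def OmegaDefectEqGenusAtTwo : Prop :=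
  ∀ (K : ℕ) [NeZero K], ¬ 4 ∣ K →
    omegaDefectIndexAtTwo (16 * K) = 2 ^ Module.finrank ℂ (CuspForm (Gamma0 K) 2)

/-- **E-imc-166♭ `OmegaDefectKilledByTwo`**: for `16 ∣ N`, `64 ∤ N`, `2 · L_red^gen(N) ⊆ Ω₂(N)` (so `σ₂^Ω(f) ≤ 1`; ENGINE 7: 334/334). -/
@[conjecture] def OmegaDefectKilledByTwo : Prop :=
  ∀ (K : ℕ) [NeZero K], ¬ 4 ∣ K →
    ∀ x ∈ kmCuspLatticeGen (16 * K), (2 : ℤ) • x ∈ omegaLatticeAtTwo (16 * K)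

/-! ### §3. Bookkeeping (PROVED): at genus-0 quotient levels the law gives `Ω = L_red` on the nose -/

/-- E-imc-165 at a genus-0 quotient level: the defect index is `1`. -/
theorem omegaDefectIndexAtThree_eq_one_of_genus_zero (h : OmegaDefectEqGenusAtThree) (M : ℕ) [NeZero M] (h9 : ¬ 9 ∣ M)
    (hg : Module.finrank ℂ (CuspForm (Gamma0 M) 2) = 0) : omegaDefectIndexAtThree (9 * M) = 1 := by
  simpa [hg] using h M h9

/-- E-imc-165 at a genus-0 quotient level: `Ω₃(9M) = L_red(9M)`. -/
theorem omega_eq_reduced_of_genus_zero (h : OmegaDefectEqGenusAtThree) (M : ℕ) [NeZero M] (h9 : ¬ 9 ∣ M)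
    (hg : Module.finrank ℂ (CuspForm (Gamma0 M) 2) = 0) :
    omegaLatticeAtThree (9 * M) = reducedCuspLatticeAtThree (9 * M) := by
  have h1 := omegaDefectIndexAtThree_eq_one_of_genus_zero h M h9 hg
  refine le_antisymm (omegaLatticeAtThree_le_reduced _) ?_
  have hle : (reducedCuspLatticeAtThree (9 * M)).toAddSubgroup ≤ (omegaLatticeAtThree (9 * M)).toAddSubgroup :=
    AddSubgroup.relIndex_eq_one.mp h1
  exact fun x hx => hle hx

/-- E-imc-166 at a genus-0 quotient level: the defect index at `2` is `1`. -/
theorem omegaDefectIndexAtTwo_eq_one_of_genus_zero (h : OmegaDefectEqGenusAtTwo) (K : ℕ) [NeZero K] (h4 : ¬ 4 ∣ K)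
    (hg : Module.finrank ℂ (CuspForm (Gamma0 K) 2) = 0) : omegaDefectIndexAtTwo (16 * K) = 1 := by
  simpa [hg] using h K h4

/-! ### §4. The STRATA-SUM sharpening (imc g22, E-imc-168): the defect is the sum, over the NON-REDUCED Katz–Mazur strata
`min(a,b) = m` with `φ(p^m) > 1` and `p^{2m} ∣ N`, of `g(X₀(N/p^{2m}))` — p = 3: strata `m ≥ 1`; p = 2: strata `m ≥ 2` (φ(2) = 1).
ENGINE 7 (kit-g20 OMG) + ENGINE 7c/7e (OMT): p = 2, `64 ∣ N` (v₂ = 6, 7): defect = g(X₀(N/16)) + g(X₀(N/64)) on 12/12 levels,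
together with E-166 59/59 for every `16 ∣ N ≤ 1008`; p = 3 at `81 ∣ N` is a PREDICTION (no engine supports `81 ∣ N` yet). -/

/-- **E-imc-168 (p = 2, second stratum) `OmegaDefectEqGenusAtTwoDeep`**: for `N = 64·M` with `4 ∤ M` (`v₂(N) ∈ {6,7}`),
`#(L_red^gen(N)/Ω₂(N)) = 2^{g(X₀(4M)) + g(X₀(M))}`.  ENGINE 7: 12/12 (N = 64 … 960). Why it might fail: first level with
`g(X₀(M)) ≥ 2` and `128 ∣ N` is beyond the table (N = 128·11 = 1408). -/
@[conjecture] def OmegaDefectEqGenusAtTwoDeep : Prop :=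
  ∀ (M : ℕ) [NeZero M], ¬ 4 ∣ M →
    omegaDefectIndexAtTwo (64 * M) =
      2 ^ (Module.finrank ℂ (CuspForm (Gamma0 (4 * M)) 2) + Module.finrank ℂ (CuspForm (Gamma0 M) 2))

/-- **E-imc-168 (p = 3, second stratum; PREDICTION, untested) `OmegaDefectEqGenusAtThreeDeep`**: for `N = 81·M` with `9 ∤ M`,
`#(L_red(N)/Ω₃(N)) = 3^{g(X₀(9M)) + g(X₀(M))}`.  No data (both engines skip `81 ∣ N`); filed as the falsifiable extrapolation. -/
@[conjecture] def OmegaDefectEqGenusAtThreeDeep : Prop :=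
  ∀ (M : ℕ) [NeZero M], ¬ 9 ∣ M →
    omegaDefectIndexAtThree (81 * M) =
      3 ^ (Module.finrank ℂ (CuspForm (Gamma0 (9 * M)) 2) + Module.finrank ℂ (CuspForm (Gamma0 M) 2))

/-! ### §5. Support lemma (N) of MEMO-imc §28.1 (imc g22, Sketch-imc-g22b.lean 57b40461bb0e7a35; PROVED): a form whose Fricke–trace to
level `N/3` VANISHES lies in the Fricke-trace lattice for free; with E-imc-160a (`OmegaEqFrickeTraceAtNine`) every such form — in particular
every `N`-new Atkin–Lehner eigenform with integral `q`-expansion — lies in `Ω₃(N)` at `9 ∥ N` (the structural reason for ENGINE 7's column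
`f_in_LOM = 1`, 798/798 rows, MEMO-imc §26).  No new law here. -/


/-- `IsThreeIntegral` is stable under integer multiples. -/
theorem isThreeIntegral_zsmul {N : ℕ} [NeZero N] {x : CuspForm (Gamma0 N) 2} (hx : IsThreeIntegral N x) (n : ℤ) :
    IsThreeIntegral N (n • x) := by
  obtain ⟨m, hm, hmem⟩ := hx
  refine ⟨m, hm, ?_⟩
  rw [smul_comm]
  exact Submodule.smul_mem _ n hmem

/-- `0` is `3`-integral. -/
theorem isThreeIntegral_zero {N : ℕ} [NeZero N] : IsThreeIntegral N (0 : CuspForm (Gamma0 N) 2) :=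
  ⟨1, by norm_num, by simp⟩

/-- **(N), lattice form.** An integral cusp form `x` with `w₃ x` 3-integral and `Tr^N_M (w_N x) = 0` lies in
`frickeTraceLatticeAtThree N M`. -/
theorem mem_frickeTraceLatticeAtThree_of_trace_eq_zero {N M : ℕ} [NeZero N] [NeZero M]
    {x : CuspForm (Gamma0 N) 2} (hx : x ∈ integralCuspForms0 N 2)
    (hw : IsThreeIntegral N (atkinLehnerInvolutionAt N 2 3 x))
    (htr : adjDegeneracyMap0 N M 1 2 (frickeInvolution N 2 x) = 0) :
    x ∈ frickeTraceLatticeAtThree N M := by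
  refine le_frickeTraceLatticeAtThree (L := Submodule.span ℤ {x}) ?_ ?_ (Submodule.mem_span_singleton_self x)
  · exact Submodule.span_le.mpr (Set.singleton_subset_iff.mpr hx)
  · intro y hy
    obtain ⟨n, rfl⟩ := Submodule.mem_span_singleton.mp hy
    refine ⟨?_, ?_⟩
    · rw [map_zsmul]
      exact isThreeIntegral_zsmul hw n
    · rw [map_zsmul, map_zsmul, htr, smul_zero]
      exact isThreeIntegral_zero

/-- **(N), eigenform form.** If `w_N x = ε • x` (a Fricke eigenvector, `ε = ±1`) and the trace of `x` itself to level
`M` vanishes (e.g. `x` is `N`-new), then `x` lies in the Fricke-trace lattice as soon as `x` and `w₃ x` are 3-integral. -/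
theorem mem_frickeTraceLatticeAtThree_of_fricke_eigen {N M : ℕ} [NeZero N] [NeZero M]
    {x : CuspForm (Gamma0 N) 2} {ε : ℂ} (hx : x ∈ integralCuspForms0 N 2)
    (hw : IsThreeIntegral N (atkinLehnerInvolutionAt N 2 3 x))
    (hW : frickeInvolution N 2 x = ε • x) (htr0 : adjDegeneracyMap0 N M 1 2 x = 0) :
    x ∈ frickeTraceLatticeAtThree N M := by
  apply mem_frickeTraceLatticeAtThree_of_trace_eq_zero hx hw
  rw [hW, map_smul, htr0, smul_zero]

/-- **(N) ⟹ membership in `Ω₃`, modulo E-imc-160a.** At `N = 3M` with `3 ∥ M` (`9 ∥ N`): a Fricke eigenvector with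
integral `q`-expansion, 3-integral `w₃`-image and vanishing trace to level `M` lies in `Ω₃(N)`. -/
theorem mem_omegaLatticeAtThree_of_fricke_eigen (h160 : OmegaEqFrickeTraceAtNine) {M : ℕ} [NeZero M]
    (h3 : 3 ∣ M) (h9 : ¬ 9 ∣ M) {x : CuspForm (Gamma0 (3 * M)) 2} {ε : ℂ}
    (hx : x ∈ integralCuspForms0 (3 * M) 2)
    (hw : IsThreeIntegral (3 * M) (atkinLehnerInvolutionAt (3 * M) 2 3 x))
    (hW : frickeInvolution (3 * M) 2 x = ε • x) (htr0 : adjDegeneracyMap0 (3 * M) M 1 2 x = 0) :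
    x ∈ omegaLatticeAtThree (3 * M) := by
  rw [h160 M h3 h9]
  exact mem_frickeTraceLatticeAtThree_of_fricke_eigen hx hw hW htr0

end Summit.BirchSwinnertonDyer.Rank1Residual.ManinAdditive.NeronOmegaGenus
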